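import Mathlib
import HarnessLib
import Summits.HubbardSuperconductivity.HubbardSuperconductivity.Theorems.KLProgrammeKLRegimeSplitGlueP4
import Summits.HubbardSuperconductivity.HubbardSuperconductivity.Theorems.KLProgrammeKLRegimeVolumeLimitExDefs
import Summits.HubbardSuperconductivity.HubbardSuperconductivity.Theorems.KLProgrammeKLRegimeSplitGlue
import Summits.HubbardSuperconductivity.HubbardSuperconductivity.Theorems.KLProgrammeKLRegimeSplitBundleV15

/-!
# Route `KLProgramme` — the K3-NAMED glue of the five gen-6 children at `klPredsV15` with the ∃-threshold volume-limit slot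
# `FinalTwoLegVolLimitEx` (stmt-HubbardSuperconductivity-19937; DOWNSTREAM of the route file; TEMPLATE by p2 g9 — file right after BundleV15 is ACCEPTED,
# `--supports stmt-HubbardSuperconductivity-19937 --as helper`; validated as `KLRegimeInductionV15P4Ex_pre` in V15_prebirth_sanity.lean §B)

`KLRegimeInductionV15P4Ex := KLRegimeInductionP4 klPredsV15 FinalTwoLegVolLimitEx` (the generic induction `KLRegimeInductionP4` is universal in the
bundle `Pr` and the volume-limit slot).  Nothing else is asserted; nothing asserts superconductivity.
-/

noncomputable section

namespace Summit.HubbardSuperconductivity.HubbardSuperconductivity.Theorems.KLRegimeSplit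

set_option linter.dupNamespace false -- summit = problem name (single-conjunct summit), D-0017

/-- **The K3-named glue at `klPredsV15` with the ∃-slot**: `EngineP4 klPredsV15 klWindowC`, `BetaSplitP klPredsV15 klWindowC`,
`CountertermP2 klPredsV15 klWindowC`, `VolumeLimitP2 klPredsV15 FinalTwoLegVolLimitEx klWindowC`, `TwoPointAssemblyP3 klPredsV15 FinalTwoLegVolLimitEx klWindowC`
imply crux K3 `KLRegimeTwoPointLimit` BY NAME. -/
theorem KLRegimeInductionV15P4Ex :
    EngineP4 klPredsV15 klWindowC → BetaSplitP klPredsV15 klWindowC → CountertermP2 klPredsV15 klWindowC →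
      VolumeLimitP2 klPredsV15 FinalTwoLegVolLimitEx klWindowC → TwoPointAssemblyP3 klPredsV15 FinalTwoLegVolLimitEx klWindowC →
        Summit.HubbardSuperconductivity.HubbardSuperconductivity.Theses.KLProgramme.KLRegimeTwoPointLimit :=
  KLRegimeInductionP4 klPredsV15 FinalTwoLegVolLimitEx

/-- **(R6-3) the bare frame is in the capped class on the covariance window**, unconditionally (`klFrameOK_zeroC` + `degree 0 ≤ cap`) — stated here,
downstream of the route file, so that `…SplitBundleV15` stays outside the route file's import cone. -/
theorem frameOKDeg_zeroC {R : RenConsts} (hR : R.WF) (U : ℝ) (N : ℕ) {μ : ℝ} (hμ : μ ∈ klWindowC) : FrameOKDeg R U N μ 0 :=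
  frameOKDeg_zero (klFrameOK_zeroC hR U N hμ)

end Summit.HubbardSuperconductivity.HubbardSuperconductivity.Theorems.KLRegimeSplit

end
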